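import Mathlib
import HarnessLib

/-!
# Crux C1 `MainConjectureTransportAlignedAtTwo` (stmt-BirchSwinnertonDyer-22296), line `birth`, residual (R2) at UNEQUAL conductors:
# the `𝔽₂`-core of the cross-level mechanism «the diagonal old plane is the `U_q`-fixed part of the `q`-old `𝔪`-torsion»
# (width seat att-p5 g18, fourth engine; memo `Cruxes/MainConjectureTransportAlignedAtTwo/CROSS-LEVEL-PLANES-att-p5-g18.md`; `--supports 22296`)

THEOREMS ONLY (no `def`, no `sorry`, no named fact; linear algebra over `ZMod 2`). BSD is not proved by this; C1 is not closed by this.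

Context. For `N₂ = q·N₁` and a newform `f₁` of level `N₁`, the `q`-old part of `J₀(N₂)` receives `J₀(N₁) × J₀(N₁)` through
`α(x, y) = α₁^* x + α_q^* y`, and Ribet's intertwining relation reads `U_q ∘ α = α ∘ (T_q  q ; −1  0)` (Ribet 1990, display after (2)).
On the `𝔪`-torsion plane `P = E₁^∨[2]` of an optimal curve (`T_q` acts as the scalar `a = a_q(E₁) mod 2`, everything killed by `2`) this is a
`ZMod 2`-linear relation `U (α (x, y)) = α (a•x + q•y, x)`, and the fourth engine's census (memo §1 check (ii)/(iii), §3) uses exactly the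
following dichotomy, proved here for an arbitrary injective `α` on `P × P`:
* **`apply_pair_eq_iff_of_add_eq_one`** — if `a + q = 1` in `ZMod 2` (odd `q` with `a_q(E₁)` even = the level-raising congruence at `2`; or
  `q = 2` with `a₂(E₁)` odd = ordinary), then `α (x, y)` is `U`-fixed iff `x = y`: the `U_q`-fixed part of the old copy `α(P × P)` is the
  DIAGONAL `D(P) = {α (x, x)}` = `(α₁^* + α_q^*) P` — the plane the census compares with `E₂^∨[2]`; as submodules
  **`range_inf_fixed_eq_map_diag_of_add_eq_one`**: `range α ⊓ {v | U v = v} = α(diagonal)`.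
* **`apply_pair_eq_iff_of_add_eq_zero`** — if `a + q = 0` (odd `q`, `a_q(E₁)` odd: no congruence), the only `U`-fixed vector of the old copy
  is `0` (**`range_inf_fixed_eq_bot_of_add_eq_zero`**): no `U_q ≡ 1` old line, matching «no `q`-new `𝔪`-congruent form» (Ribet 1990 Thm 1 at `ℓ = 2`).
* **`map_diag_inf_map_inl_eq_bot`**, **`map_diag_inf_map_inr_eq_bot`** — the diagonal meets each single degeneracy image `α(P × 0)`, `α(0 × P)`
  only in `0` (the engine's negative control: `α₁^*P`, `α_q^*P` each meet `D(P)` — and `E₂^∨[2]` — trivially).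

References: Ribet, «Raising the levels of modular representations», Sém. Théor. Nombres Paris 1987–88, Progr. Math. 81 (1990), Thm 1, Remark 3,
display after (2) [cite: Ribet1990RaisingLevels, Thm 1, Remark 3, display after (2)]; the census: memo above, §2–§3.
-/

-- justification: the `Summit.BirchSwinnertonDyer.BirchSwinnertonDyer.…` path repeats a component (route-file convention)
set_option linter.dupNamespace false
set_option autoImplicit false

namespace Summit.BirchSwinnertonDyer.BirchSwinnertonDyer.Theorems.AlignedTransportAtTwoRaisingPlanes

variable {P V : Type*} [AddCommGroup P] [Module (ZMod 2) P] [AddCommGroup V] [Module (ZMod 2) V]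

/-- In a `ZMod 2`-module, `a + q = 1` forces `a • x + q • x = x`. -/
theorem add_smul_eq_self_of_add_eq_one {a q : ZMod 2} (h : a + q = 1) (x : P) : a • x + q • x = x := by
  rw [← add_smul, h, one_smul]

/-- In a `ZMod 2`-module, `a + q = 0` forces `a • x + q • x = 0`. -/
theorem add_smul_eq_zero_of_add_eq_zero {a q : ZMod 2} (h : a + q = 0) (x : P) : a • x + q • x = 0 := by
  rw [← add_smul, h, zero_smul]

/-- **Level-raising case (`a + q = 1`): the `U`-fixed vectors of the old copy are exactly the diagonal.**
`α : P × P →ₗ V` injective (the `q`-old embedding `(x,y) ↦ α₁^*x + α_q^*y` on an `𝔪`-torsion plane), `U (α (x,y)) = α (a•x + q•y, x)`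
(Ribet's `U_q ∘ α = α ∘ (T_q q; −1 0)` mod `2`, `T_q = a` on the plane). If `a + q = 1` then `U (α (x, y)) = α (x, y) ↔ x = y`.
[cite: Ribet1990RaisingLevels, display after (2)] -/
theorem apply_pair_eq_iff_of_add_eq_one (α : P × P →ₗ[ZMod 2] V) (hα : Function.Injective α) (U : V →ₗ[ZMod 2] V) {a q : ZMod 2}
    (hU : ∀ x y : P, U (α (x, y)) = α (a • x + q • y, x)) (h : a + q = 1) (x y : P) :
    U (α (x, y)) = α (x, y) ↔ x = y := by
  rw [hU]
  constructor
  · intro hxy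
    have hpair := hα hxy
    exact (Prod.mk.inj hpair).2
  · intro hxy
    subst hxy
    rw [add_smul_eq_self_of_add_eq_one h]

/-- **No-congruence case (`a + q = 0`): the old copy has no non-zero `U`-fixed vector.** With the same intertwining relation, if `a + q = 0`
then `U (α (x, y)) = α (x, y) ↔ x = 0 ∧ y = 0`. [cite: Ribet1990RaisingLevels, Thm 1] -/
theorem apply_pair_eq_iff_of_add_eq_zero (α : P × P →ₗ[ZMod 2] V) (hα : Function.Injective α) (U : V →ₗ[ZMod 2] V) {a q : ZMod 2}
    (hU : ∀ x y : P, U (α (x, y)) = α (a • x + q • y, x)) (h : a + q = 0) (x y : P) :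
    U (α (x, y)) = α (x, y) ↔ x = 0 ∧ y = 0 := by
  rw [hU]
  constructor
  · intro hxy
    have hpair := Prod.mk.inj (hα hxy)
    obtain ⟨h1, h2⟩ := hpair
    subst h2
    refine ⟨?_, ?_⟩ <;> simpa [add_smul_eq_zero_of_add_eq_zero h] using h1.symm
  · rintro ⟨hx, hy⟩
    rw [hx, hy, smul_zero, smul_zero, add_zero]

/-- Submodule form of `apply_pair_eq_iff_of_add_eq_one`: for `a + q = 1`, `range α ⊓ Fix(U) = α(diagonal)`, where the diagonal of `P × P` is the
range of `LinearMap.id.prod LinearMap.id : P → P × P` and `Fix(U)` is the kernel of `U − 1`. This is «`D(C₁) = (q-old part of J₀(N₂)[𝔪₂])^{U_q = 1}`»,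
the identity the fourth engine verifies row by row (memo §1 (iii)). [cite: Ribet1990RaisingLevels, display after (2)] -/
theorem range_inf_fixed_eq_map_diag_of_add_eq_one (α : P × P →ₗ[ZMod 2] V) (hα : Function.Injective α) (U : V →ₗ[ZMod 2] V)
    {a q : ZMod 2} (hU : ∀ x y : P, U (α (x, y)) = α (a • x + q • y, x)) (h : a + q = 1) :
    LinearMap.range α ⊓ LinearMap.ker (U - 1) =
      Submodule.map α (LinearMap.range ((LinearMap.id : P →ₗ[ZMod 2] P).prod LinearMap.id)) := by
  ext v
  constructor
  · rintro ⟨⟨⟨x, y⟩, rfl⟩, hfix⟩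
    have hfix' : (U - 1) (α (x, y)) = 0 := hfix
    rw [LinearMap.sub_apply, Module.End.one_apply, sub_eq_zero] at hfix'
    have hxy : x = y := (apply_pair_eq_iff_of_add_eq_one α hα U hU h x y).1 hfix'
    subst hxy
    exact ⟨(x, x), ⟨x, rfl⟩, rfl⟩
  · rintro ⟨p, ⟨x, rfl⟩, rfl⟩
    refine ⟨⟨(x, x), rfl⟩, ?_⟩
    change (U - 1) (α (x, x)) = 0
    rw [LinearMap.sub_apply, Module.End.one_apply, sub_eq_zero]
    exact (apply_pair_eq_iff_of_add_eq_one α hα U hU h x x).2 rfl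

/-- Submodule form of `apply_pair_eq_iff_of_add_eq_zero`: for `a + q = 0`, `range α ⊓ Fix(U) = ⊥` — no `U_q ≡ 1` line in the old copy, i.e.
no level raising mod `2` at `q` from this plane. [cite: Ribet1990RaisingLevels, Thm 1] -/
theorem range_inf_fixed_eq_bot_of_add_eq_zero (α : P × P →ₗ[ZMod 2] V) (hα : Function.Injective α) (U : V →ₗ[ZMod 2] V)
    {a q : ZMod 2} (hU : ∀ x y : P, U (α (x, y)) = α (a • x + q • y, x)) (h : a + q = 0) :
    LinearMap.range α ⊓ LinearMap.ker (U - 1) = ⊥ := by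
  rw [Submodule.eq_bot_iff]
  rintro v ⟨⟨⟨x, y⟩, rfl⟩, hfix⟩
  have hfix' : (U - 1) (α (x, y)) = 0 := hfix
  rw [LinearMap.sub_apply, Module.End.one_apply, sub_eq_zero] at hfix'
  obtain ⟨hx, hy⟩ := (apply_pair_eq_iff_of_add_eq_zero α hα U hU h x y).1 hfix'
  rw [hx, hy, Prod.mk_zero_zero, map_zero]

/-- The diagonal old plane meets the first single degeneracy image only in `0`: `α(diagonal) ⊓ α(P × 0) = ⊥` for injective `α`
(the engine's negative control «`α₁^*P ∩ D(P) = 0`»). -/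
theorem map_diag_inf_map_inl_eq_bot (α : P × P →ₗ[ZMod 2] V) (hα : Function.Injective α) :
    Submodule.map α (LinearMap.range ((LinearMap.id : P →ₗ[ZMod 2] P).prod LinearMap.id)) ⊓
      Submodule.map α (LinearMap.range (LinearMap.inl (ZMod 2) P P)) = ⊥ := by
  rw [Submodule.eq_bot_iff]
  rintro v ⟨⟨p, ⟨x, rfl⟩, rfl⟩, ⟨p', ⟨x', rfl⟩, h'⟩⟩
  have hpair : (x', (0 : P)) = (x, x) := by
    have := hα h'
    simpa [LinearMap.inl_apply, LinearMap.prod_apply] using this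
  obtain ⟨h1, h2⟩ := Prod.mk.inj hpair
  have hx : x = 0 := h2.symm
  subst hx
  change α ((0 : P), (0 : P)) = 0
  rw [Prod.mk_zero_zero, map_zero]

/-- The diagonal old plane meets the second single degeneracy image only in `0`: `α(diagonal) ⊓ α(0 × P) = ⊥` for injective `α`
(the engine's negative control «`α_q^*P ∩ D(P) = 0`»). -/
theorem map_diag_inf_map_inr_eq_bot (α : P × P →ₗ[ZMod 2] V) (hα : Function.Injective α) :
    Submodule.map α (LinearMap.range ((LinearMap.id : P →ₗ[ZMod 2] P).prod LinearMap.id)) ⊓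
      Submodule.map α (LinearMap.range (LinearMap.inr (ZMod 2) P P)) = ⊥ := by
  rw [Submodule.eq_bot_iff]
  rintro v ⟨⟨p, ⟨x, rfl⟩, rfl⟩, ⟨p', ⟨x', rfl⟩, h'⟩⟩
  have hpair : ((0 : P), x') = (x, x) := by
    have := hα h'
    simpa [LinearMap.inr_apply, LinearMap.prod_apply] using this
  obtain ⟨h1, h2⟩ := Prod.mk.inj hpair
  have hx : x = 0 := h1.symm
  subst hx
  change α ((0 : P), (0 : P)) = 0
  rw [Prod.mk_zero_zero, map_zero]

end Summit.BirchSwinnertonDyer.BirchSwinnertonDyer.Theorems.AlignedTransportAtTwoRaisingPlanes
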